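import Summits.HubbardSuperconductivity.HubbardSuperconductivity.Theorems.AnisotropyChordThermalChordEndpoints

/-!
# Route `AnisotropyChord`, crux `ChordXY` (stmt-HubbardSuperconductivity-8146), line `thermal_af`:
# the registered stub `stub_thermalChordAF` from CONCAVITY of the canonical sector condensate in `Δ`
# on `[-1, 0]` (the engine statement, typed as a hypothesis)

Notation (defs of `…Theorems.AnisotropyChordThermalCondensateDefs`):
`Λ_{β,M}(Δ) = thermalCondensate M β Δ`, the condensate of the canonical `S^z_tot = 0` sector state of
`H_M(Δ) = xxzHamiltonian 1 (torusGraph 2 M) (-1) Δ`.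

The route's intended engine for the thermal chord is a SIGN on the second `Δ`-derivative of `Λ_{β,M}`
("`(log Λ_β)'' = Var_worm(𝒜) − Var_closed(𝒜)`", a variance comparison in the stoquastic path-integral
representation), i.e. concavity of `Δ ↦ Λ_{β,M}(Δ)` on the antiferromagnetic side. This file isolates
the elementary convexity step, so that the stub is reduced to EXACTLY that statement:

* `chord_of_concaveOn_of_nonneg` — a real function concave on `[-1,0]` and nonnegative at `-1` lies
  above the chord from `(-1, 0)` to `(0, f 0)`: `(1+Δ)·f 0 ≤ f Δ` on `[-1,0]`;
* **`thermalChordAF_of_concaveOn`** — if `Λ_{β,M}` is concave on `[-1,0]` then the thermal chord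
  `(1+Δ)·Λ_{β,M}(0) ≤ Λ_{β,M}(Δ)` holds at that `β` for every `Δ ∈ [-1,0]` (`Λ_{β,M}(-1) ≥ 0` is
  `thermalCondensate_nonneg`);
* **`stub_thermalChordAF_of_eventually_concaveOn`** — the registered stub `stub_thermalChordAF`
  (verbatim conclusion) from EVENTUAL (in `β`) concavity of `Λ_{β,M}` on `[-1,0]` for every even `M ≥ 4`;
  `stub_thermalChordAF_of_concaveOn` — from concavity at every `β ≥ 0` (the natural form of a
  correlation-inequality proof).

No concavity is proved here (that is the open engine); no crux closes. Sources: the route card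
(GHS-type inequality, doi:10.1063/1.1665211; Benassi–Lees–Ueltschi 2016 §1 for the open status in the
quantum XXZ model). Elementary; no definition is introduced.
-/

set_option linter.dupNamespace false

noncomputable section

namespace Summit.HubbardSuperconductivity.HubbardSuperconductivity.Theorems.AnisotropyChord

open Filter Topology
open Literature.MathematicalPhysics.QuantumLattice Literature.Probability.LatticeModels

/-- **A concave function on `[-1,0]`, nonnegative at `-1`, lies above the chord to the origin side**:
`(1+Δ)·f 0 ≤ f Δ` for `Δ ∈ [-1,0]` (concavity at the points `-1`, `0` with weights `-Δ`, `1+Δ`, then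
drop the nonnegative term `(-Δ)·f(-1)`). [folklore] -/
theorem chord_of_concaveOn_of_nonneg {f : ℝ → ℝ} (hf : ConcaveOn ℝ (Set.Icc (-1:ℝ) 0) f)
    (h0 : 0 ≤ f (-1)) {Δ : ℝ} (hΔ : Δ ∈ Set.Icc (-1:ℝ) 0) : (1 + Δ) * f 0 ≤ f Δ := by
  have hm1 : (-1:ℝ) ∈ Set.Icc (-1:ℝ) 0 := ⟨le_rfl, by norm_num⟩
  have hz : (0:ℝ) ∈ Set.Icc (-1:ℝ) 0 := ⟨by norm_num, le_rfl⟩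
  have ha : 0 ≤ -Δ := by linarith [hΔ.2]
  have hb : 0 ≤ 1 + Δ := by linarith [hΔ.1]
  have h := hf.2 hm1 hz ha hb (by ring)
  simp only [smul_eq_mul, mul_neg, mul_one, neg_neg, mul_zero, add_zero] at h
  -- h : -Δ * f (-1) + (1 + Δ) * f 0 ≤ f Δ
  nlinarith [mul_nonneg ha h0]

/-- **The thermal chord from concavity in `Δ`.** If at inverse temperature `β` the canonical sector
condensate `Δ ↦ Λ_{β,M}(Δ)` is concave on `[-1,0]`, then `(1+Δ)·Λ_{β,M}(0) ≤ Λ_{β,M}(Δ)` for every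
`Δ ∈ [-1,0]` (with `Λ_{β,M}(-1) ≥ 0`, `thermalCondensate_nonneg`). [folklore] -/
theorem thermalChordAF_of_concaveOn (M : ℕ) [NeZero M] (β : ℝ)
    (hc : ConcaveOn ℝ (Set.Icc (-1:ℝ) 0) (fun Δ : ℝ => thermalCondensate M β Δ)) :
    ∀ Δ ∈ Set.Icc (-1:ℝ) 0, (1 + Δ) * thermalCondensate M β 0 ≤ thermalCondensate M β Δ :=
  fun _ hΔ => chord_of_concaveOn_of_nonneg hc (thermalCondensate_nonneg M β (-1)) hΔ

/-- **Registered stub `stub_thermalChordAF` (ChordXY skeleton `c9438cf6…`) from EVENTUAL CONCAVITY of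
the canonical sector condensate in the anisotropy on `[-1,0]`** — the engine statement of line
`thermal_af` as a hypothesis, the stub's conclusion verbatim. [folklore] -/
theorem stub_thermalChordAF_of_eventually_concaveOn
    (hconc : ∀ (M : ℕ) [NeZero M], Even M → 4 ≤ M →
      ∀ᶠ β : ℝ in atTop, ConcaveOn ℝ (Set.Icc (-1:ℝ) 0) (fun Δ : ℝ => thermalCondensate M β Δ)) :
    ∀ (M : ℕ) [NeZero M], Even M → 4 ≤ M → ∀ Δ ∈ Set.Icc (-1:ℝ) 0,
      ∀ᶠ β : ℝ in atTop, (1 + Δ) * thermalCondensate M β 0 ≤ thermalCondensate M β Δ := by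
  intro M _ hE h4 Δ hΔ
  exact (hconc M hE h4).mono fun β hβ => thermalChordAF_of_concaveOn M β hβ Δ hΔ

/-- The same from concavity at EVERY `β ≥ 0` (the form a correlation-inequality / variance-comparison
proof would deliver). [folklore] -/
theorem stub_thermalChordAF_of_concaveOn
    (hconc : ∀ (M : ℕ) [NeZero M], Even M → 4 ≤ M → ∀ β : ℝ, 0 ≤ β →
      ConcaveOn ℝ (Set.Icc (-1:ℝ) 0) (fun Δ : ℝ => thermalCondensate M β Δ)) :
    ∀ (M : ℕ) [NeZero M], Even M → 4 ≤ M → ∀ Δ ∈ Set.Icc (-1:ℝ) 0,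
      ∀ᶠ β : ℝ in atTop, (1 + Δ) * thermalCondensate M β 0 ≤ thermalCondensate M β Δ :=
  stub_thermalChordAF_of_eventually_concaveOn fun M _ hE h4 =>
    (eventually_ge_atTop (0:ℝ)).mono fun β hβ => hconc M hE h4 β hβ

end Summit.HubbardSuperconductivity.HubbardSuperconductivity.Theorems.AnisotropyChord

end
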